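/-
Copyright (c) 2026 the pub-hodgecm-mathlib formalisation cell (harness21).  Prover seat hodgecm-mathlib-F0P3-p01 (g32), Track A «(D-RAM) FOUR-FRAME», unit U2H, census leaf
(ρ2b′-X) — T5b «toric level census, type RamK», anisotropic side: splitting a `Θ`-fixed side scalar as (ρ-anti-fixed)·(Θ-fixed unit) (organ B5).  2026-09-04.
-/
import Literature.NumberTheory.LocalFields.QuadraticOrderNormTwistClasses   -- ★ p857299 (LH4-p08 (g4)): the frame letters (brings Mathlib valuations)
import HarnessLib

/-!
# Unit Hilbert 90 for an unramified involution, and the splitting `h = h₊·n₀` of a `Θ`-fixed scalar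
(Serre, *Local Fields* Ch. V §2 Prop. 3, Ch. X §1 Prop. 2; Jacobowitz 1962 §4)

Topic `NumberTheory/LocalFields`; namespace `Literature.NumberTheory.LocalFields.QuadraticOrder`.  THEOREMS ONLY (no definition, no instance, no notation, no named fact, no
`sorry`); kernel lane `--supports stmt-HodgeConjecture-24833` (count-neutral).  Cell `pub/hodgecm-mathlib` (D-0151), crux H413, Track A, unit U2H, census leaf (ρ2b′-X), type RamK,
ANISOTROPIC side.  The level counts of ★ `Theorems/F0P3cDyRamToricLevelCensusRamK` ED. 2 are stated for a side scalar `h = h₊·n₀` with `ρh₊ = −h₊` and `n₀` a (`Θ`-fixed,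
non-norm) unit; THIS FILE produces that splitting for every `Θ`-fixed `h ≠ 0` in the two-field RamK frame (`K' ≅ Fix Θ` via `jK`, `jK∘σ' = ρ∘jK`, `K'` unramified over
`Fix σ'`: `|α'| ≤ 1`, `|α' − σ'α'| = 1`): **`exists_unit_map_eq_mul_of_mul_map_eq_one`** — unit Hilbert 90 (for `ε·σε = 1` a unit `m` with `σm = ε·m`: `m = 1 + σε` or
`α + σε·σα`); **`exists_antiFixed_mul_unit_of_theta_fixed`** — `h = h₊·n₀`, `ρh₊ = −h₊`, `h₊ ≠ 0`, `Θh₊ = h₊`, `Θn₀ = n₀`, `|n₀| = 1`; and **`isotropic_of_mul_map_eq`** — if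
`n₀` is a norm `ωΘω` then `h` is isotropic (`x = ω⁻¹` gives `hΘx·x = h₊`), so an ANISOTROPIC `h` has a non-norm `n₀`.
HONEST LABEL: HC_CM is proved only modulo the 7 printed citations (2 remaining named inputs: hLiu418 = stmt-HodgeConjecture-24832, h413 = stmt-HodgeConjecture-24833) until rung 0
closes; unconditional local algebra, count-neutral.

## References
* [Serre1979] J.-P. Serre, *Local Fields*, GTM 67 (1979): Ch. V §2 Prop. 3 (units of an unramified extension), Ch. X §1 Prop. 2 (Hilbert 90).
* [Jacobowitz1962] R. Jacobowitz, *Hermitian forms over local fields*, Amer. J. Math. 84 (1962): §4.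
-/

set_option autoImplicit false

open WithZero
open scoped Valued

namespace Literature.NumberTheory.LocalFields.QuadraticOrder

section UnitHilbert90

variable {K : Type*} [Field K] [Valued K ℤᵐ⁰] {σ : K →+* K} {α : K}

/-- **UNIT HILBERT 90 (unramified involution)**: if `σ` is an isometric involution and `|α| ≤ 1`, `|α − σα| = 1`, then every `ε` with `ε·σε = 1` is `σm∕m` for a UNIT `m`:
`σm = ε·m`, `|m| = 1` (`m = 1 + σε` if that is a unit, else `m = α + σε·σα`). [cite: Serre1979, Ch. V §2 Prop. 3] [cite: Serre1979, Ch. X §1 Prop. 2] -/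
theorem exists_unit_map_eq_mul_of_mul_map_eq_one (hσ : ∀ x, σ (σ x) = x) (hvσ : ∀ x, Valued.v (σ x) = Valued.v x)
    (hα1 : Valued.v α ≤ 1) (hα : Valued.v (α - σ α) = 1) {ε : K} (hε : ε * σ ε = 1) :
    ∃ m : K, Valued.v m = 1 ∧ σ m = ε * m := by
  have hvε : Valued.v ε = 1 := by
    have h1 := congrArg Valued.v hε
    rw [map_mul, hvσ, map_one] at h1
    rcases lt_trichotomy (Valued.v ε) 1 with h | h | h
    · exact absurd h1 (ne_of_lt (mul_lt_one_of_nonneg_of_lt_one_left zero_le h h.le))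
    · exact h
    · exact absurd h1 (ne_of_gt (one_lt_mul_of_lt_of_le h h.le))
  have hvδ : Valued.v (σ ε) = 1 := by rw [hvσ, hvε]
  -- `σ(y + σε·σy) = ε·(y + σε·σy)` for every `y`
  have key : ∀ y : K, σ (y + σ ε * σ y) = ε * (y + σ ε * σ y) := fun y => by
    rw [map_add, map_mul, hσ, hσ, mul_add, ← mul_assoc, hε, one_mul, add_comm]
  by_cases h1 : Valued.v (1 + σ ε) = 1
  · exact ⟨1 + σ ε, h1, by have := key 1; rwa [map_one, mul_one] at this⟩
  · -- `|1 + σε| < 1`: take `y = α`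
    have hlt : Valued.v (1 + σ ε) < 1 :=
      lt_of_le_of_ne ((Valuation.map_add _ _ _).trans (by rw [Valuation.map_one, hvδ, max_self])) h1
    refine ⟨α + σ ε * σ α, ?_, key α⟩
    have hsplit : α + σ ε * σ α = (α - σ α) + (1 + σ ε) * σ α := by ring
    rw [hsplit, Valuation.map_add_eq_of_lt_left]
    · exact hα
    · rw [hα, map_mul, hvσ]
      calc Valued.v (1 + σ ε) * Valued.v α ≤ Valued.v (1 + σ ε) * 1 := mul_le_mul' le_rfl hα1
        _ < 1 := by rw [mul_one]; exact hlt

end UnitHilbert90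

section Splitting

variable {K K' : Type} [Field K] [Valued K ℤᵐ⁰] [Field K'] [Valued K' ℤᵐ⁰] {ρ Θ : K →+* K} {σ' : K' →+* K'} {α' : K'}

/-- **SPLITTING A `Θ`-FIXED SCALAR**: in the two-field frame (`jK : K' → M` onto `Fix Θ`, `jK∘σ' = ρ∘jK`, `K'` unramified over `Fix σ'`), every `Θ`-fixed `h ≠ 0` is
`h = h₊·n₀` with `ρh₊ = −h₊`, `h₊ ≠ 0`, `Θh₊ = h₊`, `Θn₀ = n₀`, `|n₀| = 1` (unit Hilbert 90 applied to `ε = −σ's'∕s'`, `jK s' = h`). [cite: Serre1979, Ch. V §2 Prop. 3]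
[cite: Jacobowitz1962, §4] -/
theorem exists_antiFixed_mul_unit_of_theta_fixed (hσ' : ∀ x, σ' (σ' x) = x) (hvσ' : ∀ x, Valued.v (σ' x) = Valued.v x)
    (hα'1 : Valued.v α' ≤ 1) (hα' : Valued.v (α' - σ' α') = 1)
    (jK : K' →+* K) (hjv : ∀ x, Valued.v (jK x) = Valued.v x ^ 2) (hjΘ : ∀ x, Θ (jK x) = jK x) (hjfix : ∀ z : K, Θ z = z → ∃ x, jK x = z)
    (hjσ : ∀ x, jK (σ' x) = ρ (jK x)) {h : K} (hΘh : Θ h = h) (hh : h ≠ 0) :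
    ∃ hp n₀ : K, h = hp * n₀ ∧ ρ hp = -hp ∧ hp ≠ 0 ∧ Θ hp = hp ∧ Θ n₀ = n₀ ∧ Valued.v n₀ = 1 := by
  obtain ⟨s', hs'⟩ := hjfix h hΘh
  have hs'0 : s' ≠ 0 := by rintro rfl; rw [map_zero] at hs'; exact hh hs'.symm
  have hσs'0 : σ' s' ≠ 0 := (map_ne_zero σ').2 hs'0
  -- the cocycle `ε = −σ's'∕s'`
  have hε : (-(σ' s' / s')) * σ' (-(σ' s' / s')) = 1 := by
    rw [map_neg, map_div₀, hσ', neg_mul_neg, div_mul_div_comm, mul_comm (σ' s') s', div_self (mul_ne_zero hs'0 hσs'0)]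
  obtain ⟨m, hm1, hσm⟩ := exists_unit_map_eq_mul_of_mul_map_eq_one hσ' hvσ' hα'1 hα' hε
  have hm0 : m ≠ 0 := fun h0 => by rw [h0, map_zero] at hm1; exact zero_ne_one hm1
  refine ⟨jK (s' / m), jK m, ?_, ?_, ?_, hjΘ _, hjΘ _, ?_⟩
  · rw [← map_mul, div_mul_cancel₀ _ hm0, hs']
  · rw [← hjσ, ← map_neg, map_div₀, hσm]
    congr 1
    field_simp
  · exact (map_ne_zero jK).2 (div_ne_zero hs'0 hm0)
  · rw [hjv, hm1, one_pow]

omit [Valued K ℤᵐ⁰] in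
/-- **A NORM UNIT PART MAKES `h` ISOTROPIC**: if `h = h₊·n₀` with `ρh₊ = −h₊` and `n₀ = ωΘω`, then `x = ω⁻¹` is an isotropic vector: `hΘx·x + ρ(hΘx·x) = 0`, `x ≠ 0`.  Hence an
ANISOTROPIC side scalar has a NON-NORM unit part. [cite: Jacobowitz1962, §4] -/
theorem isotropic_of_mul_map_eq {hp n₀ : K} (hρh : ρ hp = -hp) (hn₀ : n₀ ≠ 0) {ω : K} (hω : ω * Θ ω = n₀) :
    ∃ x : K, x ≠ 0 ∧ hp * n₀ * Θ x * x + ρ (hp * n₀ * Θ x * x) = 0 := by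
  have hω0 : ω ≠ 0 := fun h0 => hn₀ (by rw [← hω, h0, zero_mul])
  have hΘω0 : Θ ω ≠ 0 := (map_ne_zero Θ).2 hω0
  refine ⟨ω⁻¹, inv_ne_zero hω0, ?_⟩
  have hred : hp * n₀ * Θ ω⁻¹ * ω⁻¹ = hp := by
    rw [← hω, map_inv₀]; field_simp
  rw [hred, hρh, add_neg_cancel]

end Splitting

end Literature.NumberTheory.LocalFields.QuadraticOrder
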